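import Literature.Probability.Process.BrownianTube
import Literature.Probability.RandomPlanarGeometry.SLE
import Mathlib.Topology.ContinuousMap.Weierstrass
import Mathlib.Analysis.Calculus.MeanValue
import Mathlib.Analysis.Calculus.Deriv.Polynomial
import HarnessLib

/-!
# Wiener measure charges every sup-norm tube around a continuous path (line `boundary-area-law`, RS5c, L3)

Line `boundary-area-law` of the crux `SubseqIdentification` (stmt-CriticalPhenomena-0783),
restriction reshape (lead c4), residual stub L3 `stub_compensatorEssUnbounded` (essential
unboundedness of the LSW compensator on the avoidance event). The route re-derives it from the
NON-CONSTANCY of the compensator, by steering the SLE driving function `√κ B` along an explicit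
driver (the vertical slit of `…CompensatorVerticalSlit`) with positive probability. The
probabilistic input is the lower-bound half of the SUPPORT THEOREM for Wiener measure:

* `measure_forall_abs_brownian_sub_le_pos_of_continuousOn` — for every `t ≥ 0`, `ε > 0` and every
  centre `f : ℝ≥0 → ℝ` with `f 0 = 0` continuous on `[0, t]`,
  `P(∀ s ≤ t, |B_s − f s| ≤ ε) > 0` for the canonical Brownian motion under the pre-Wiener measure;
* `wienerTube_pos` (registered, explicit binders) — the strict-inequality form for continuous `f`;
* `measure_forall_abs_sleDriving_sub_lt_pos` — the same for the SLE_κ driving function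
  `W = √κ B` (`κ > 0`): `P(∀ s ≤ t, |W_s − U s| < η) > 0` for every centre `U` with `U 0 = 0`
  continuous on `[0, t]` — the form consumed with the driver-stability estimates
  (`LoewnerDriverStability*`) to steer the SLE Loewner chain along a prescribed driver.

The tree's `measure_forall_abs_brownian_sub_le_pos` (`BrownianTube.lean`, the block method of
Freedman §1.6) is the case of LIPSCHITZ centres; continuous centres follow by uniform approximation:
by Weierstrass (`exists_polynomial_near_of_continuousOn`) there is a polynomial `p` with
`|p − f| < ε/4` on `[0, t]`; the centre `g = p − p(0)` has `g 0 = 0`, is Lipschitz on `[0, t]` (mean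
value theorem, `p'` bounded on the compact interval) and `|g − f| ≤ ε/2` on `[0, t]`, so the
`ε/2`-tube around `g` lies in the `ε`-tube around `f`.

References: D. Freedman, *Brownian Motion and Diffusion* (1971), §1.6; D. W. Stroock,
S. R. S. Varadhan, *On the support of diffusion processes* (Proc. Sixth Berkeley Symp. III, 1972),
§3. No named fact is used.
-/

noncomputable section

open MeasureTheory Filter Topology Set Metric
open scoped NNReal ENNReal
open Literature.Probability.Process

namespace Summit.CriticalPhenomena.SAWScalingLimit.Theorems.SubseqIdentification.BoundaryAreaLaw

/-! ### Lipschitz (polynomial) approximation of a continuous centre -/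

/-- **A continuous centre is uniformly close to a Lipschitz centre vanishing at `0`.** For `f` with
`f 0 = 0` continuous on `[0, t]` and `δ > 0` there are `L ≥ 0` and `g : ℝ≥0 → ℝ` with `g 0 = 0`,
`|g u − g s| ≤ L (u − s)` for `s ≤ u ≤ t`, and `|g s − f s| ≤ δ` for `s ≤ t` (Weierstrass
approximation by a polynomial `p`, `g = p − p(0)`, and the mean value theorem). [folklore] -/
theorem exists_lipschitz_centre_near {f : ℝ≥0 → ℝ} {t : ℝ≥0}
    (hf : ContinuousOn f (Set.Icc 0 t)) (hf0 : f 0 = 0) {δ : ℝ} (hδ : 0 < δ) :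
    ∃ L : ℝ, 0 ≤ L ∧ ∃ g : ℝ≥0 → ℝ, g 0 = 0 ∧
      (∀ s u : ℝ≥0, s ≤ u → u ≤ t → |g u - g s| ≤ L * ((u : ℝ) - s)) ∧
      ∀ s : ℝ≥0, s ≤ t → |g s - f s| ≤ δ := by
  -- the centre read on real times
  set F : ℝ → ℝ := fun x ↦ f x.toNNReal with hF
  have hFc : ContinuousOn F (Set.Icc (0 : ℝ) t) := by
    refine hf.comp continuous_real_toNNReal.continuousOn fun x hx ↦ ⟨bot_le, ?_⟩
    rw [← NNReal.coe_le_coe, Real.coe_toNNReal x hx.1]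
    exact hx.2
  obtain ⟨p, hp⟩ := exists_polynomial_near_of_continuousOn 0 t F hFc (δ / 2) (by positivity)
  -- a bound for `p'` on `[0, t]`
  obtain ⟨C, hC⟩ := (isCompact_Icc (a := (0 : ℝ)) (b := t)).exists_bound_of_continuousOn
    (f := fun x ↦ p.derivative.eval x) (Polynomial.continuous _).continuousOn
  refine ⟨max C 0, le_max_right _ _, fun s ↦ p.eval (s : ℝ) - p.eval 0, by simp, ?_, ?_⟩
  · intro s u hsu hut
    have hs : (s : ℝ) ∈ Set.Icc (0 : ℝ) t := ⟨s.coe_nonneg, NNReal.coe_le_coe.2 (hsu.trans hut)⟩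
    have hu : (u : ℝ) ∈ Set.Icc (0 : ℝ) t := ⟨u.coe_nonneg, NNReal.coe_le_coe.2 hut⟩
    have key := (convex_Icc (0 : ℝ) t).norm_image_sub_le_of_norm_deriv_le
      (f := fun x ↦ p.eval x) (C := max C 0) (fun x _ ↦ p.differentiableAt)
      (fun x hx ↦ by rw [Polynomial.deriv]; exact (hC x hx).trans (le_max_left _ _)) hs hu
    rw [Real.norm_eq_abs, Real.norm_eq_abs, abs_of_nonneg (sub_nonneg.2 (NNReal.coe_le_coe.2 hsu))]
      at key
    simpa [sub_sub_sub_cancel_right] using key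
  · intro s hs
    have hs' : (s : ℝ) ∈ Set.Icc (0 : ℝ) t := ⟨s.coe_nonneg, NNReal.coe_le_coe.2 hs⟩
    have h0 : (0 : ℝ) ∈ Set.Icc (0 : ℝ) t := ⟨le_rfl, t.coe_nonneg⟩
    have h1 := hp s hs'
    have h2 := hp 0 h0
    rw [hF] at h1 h2
    simp only [Real.toNNReal_coe] at h1
    simp only [Real.toNNReal_zero, hf0, sub_zero] at h2
    calc |p.eval (s : ℝ) - p.eval 0 - f s| = |(p.eval (s : ℝ) - f s) - p.eval 0| := by ring_nf
      _ ≤ |p.eval (s : ℝ) - f s| + |p.eval 0| := abs_sub _ _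
      _ ≤ δ / 2 + δ / 2 := add_le_add h1.le h2.le
      _ = δ := by ring

/-! ### The tube theorem for continuous centres -/

/-- **Tubes around continuous paths have positive Wiener measure** (the support theorem for Wiener
measure, lower bound): for every `t ≥ 0`, `ε > 0` and every `f : ℝ≥0 → ℝ` with `f 0 = 0`
continuous on `[0, t]`, `P(∀ s ≤ t, |B_s − f s| ≤ ε) > 0` for the canonical Brownian motion under
the pre-Wiener measure — the `ε/2`-tube around a Lipschitz centre `g` with `|g − f| ≤ ε/2` on
`[0, t]` (`exists_lipschitz_centre_near`) lies in the `ε`-tube around `f`, and has positive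
probability by the tree's Lipschitz case `measure_forall_abs_brownian_sub_le_pos`.
Freedman (1971), §1.6; Stroock–Varadhan (1972), §3. [folklore] -/
theorem measure_forall_abs_brownian_sub_le_pos_of_continuousOn (t : ℝ≥0) {ε : ℝ} (hε : 0 < ε)
    {f : ℝ≥0 → ℝ} (hf : ContinuousOn f (Set.Icc 0 t)) (hf0 : f 0 = 0) :
    0 < preWienerMeasure {ω | ∀ s : ℝ≥0, s ≤ t → |brownian s ω - f s| ≤ ε} := by
  obtain ⟨L, hL, g, hg0, hgL, hgf⟩ := exists_lipschitz_centre_near hf hf0 (half_pos hε)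
  refine lt_of_lt_of_le (measure_forall_abs_brownian_sub_le_pos t (half_pos hε) hL hg0 hgL)
    (measure_mono fun ω hω s hs ↦ ?_)
  calc |brownian s ω - f s| = |(brownian s ω - g s) + (g s - f s)| := by ring_nf
    _ ≤ |brownian s ω - g s| + |g s - f s| := abs_add_le _ _
    _ ≤ ε / 2 + ε / 2 := add_le_add (hω s hs) (hgf s hs)
    _ = ε := by ring

/-- **The same for a continuous centre on `ℝ≥0`.** [folklore] -/
theorem measure_forall_abs_brownian_sub_le_pos_of_continuous (t : ℝ≥0) {ε : ℝ} (hε : 0 < ε)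
    {f : ℝ≥0 → ℝ} (hf : Continuous f) (hf0 : f 0 = 0) :
    0 < preWienerMeasure {ω | ∀ s : ℝ≥0, s ≤ t → |brownian s ω - f s| ≤ ε} :=
  measure_forall_abs_brownian_sub_le_pos_of_continuousOn t hε hf.continuousOn hf0

/-- **Open tubes**: `P(∀ s ≤ t, |B_s − f s| < ε) > 0` for a continuous centre with `f 0 = 0`
(the closed `ε/2`-tube lies in the open `ε`-tube). [folklore] -/
theorem measure_forall_abs_brownian_sub_lt_pos_of_continuousOn (t : ℝ≥0) {ε : ℝ} (hε : 0 < ε)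
    {f : ℝ≥0 → ℝ} (hf : ContinuousOn f (Set.Icc 0 t)) (hf0 : f 0 = 0) :
    0 < preWienerMeasure {ω | ∀ s : ℝ≥0, s ≤ t → |brownian s ω - f s| < ε} :=
  lt_of_lt_of_le (measure_forall_abs_brownian_sub_le_pos_of_continuousOn t (half_pos hε) hf hf0)
    (measure_mono fun _ hω s hs ↦ (hω s hs).trans_lt (half_lt_self hε))

/-! ### The SLE driving function -/

/-- **Tubes for the SLE_κ driving function `W = √κ B`**: for `κ > 0`, every centre `U` with
`U 0 = 0` continuous on `[0, t]` and every `η > 0`, `P(∀ s ≤ t, |W_s − U s| < η) > 0` — the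
Brownian tube of radius `η/√κ` around `U/√κ`. [folklore] -/
theorem measure_forall_abs_sleDriving_sub_lt_pos {κ : ℝ≥0} (hκ : 0 < κ) (t : ℝ≥0) {η : ℝ}
    (hη : 0 < η) {U : ℝ≥0 → ℝ} (hU : ContinuousOn U (Set.Icc 0 t)) (hU0 : U 0 = 0) :
    0 < preWienerMeasure {ω | ∀ s : ℝ≥0, s ≤ t →
      |Literature.Probability.RandomPlanarGeometry.sleDriving κ ω s - U s| < η} := by
  set c : ℝ := Real.sqrt κ with hc
  have hcpos : 0 < c := Real.sqrt_pos.2 (NNReal.coe_pos.2 hκ)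
  have hf : ContinuousOn (fun s ↦ U s / c) (Set.Icc 0 t) := hU.div_const c
  have hf0 : U 0 / c = 0 := by rw [hU0, zero_div]
  refine lt_of_lt_of_le (measure_forall_abs_brownian_sub_lt_pos_of_continuousOn t
    (div_pos hη hcpos) hf hf0) (measure_mono fun ω hω s hs ↦ ?_)
  have h := hω s hs
  have heq : Literature.Probability.RandomPlanarGeometry.sleDriving κ ω s - U s =
      c * (brownian s ω - U s / c) := by
    rw [Literature.Probability.RandomPlanarGeometry.sleDriving_apply, mul_sub, mul_div_cancel₀ _ hcpos.ne']
  rw [Set.mem_setOf_eq] at *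
  rw [heq, abs_mul, abs_of_pos hcpos]
  calc c * |brownian s ω - U s / c| < c * (η / c) := mul_lt_mul_of_pos_left h hcpos
    _ = η := mul_div_cancel₀ _ hcpos.ne'

/-! ### Registered form -/

/-- **Registered helper `wienerTube_pos`**: for every continuous `f : ℝ≥0 → ℝ` with `f 0 = 0`,
every horizon `t` and every `ε > 0`, the sup-norm tube `{∀ s ≤ t, |B_s − f s| < ε}` has positive
pre-Wiener measure (support theorem for Wiener measure, lower-bound half).
Freedman (1971), §1.6; Stroock–Varadhan (1972), §3. [folklore] -/
theorem wienerTube_pos :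
    ∀ (f : ℝ≥0 → ℝ), Continuous f → f 0 = 0 → ∀ (t : ℝ≥0) (ε : ℝ), 0 < ε →
      0 < preWienerMeasure {ω : ℝ≥0 → ℝ | ∀ s : ℝ≥0, s ≤ t → |brownian s ω - f s| < ε} :=
  fun _ hf hf0 t _ hε ↦ measure_forall_abs_brownian_sub_lt_pos_of_continuousOn t hε hf.continuousOn hf0

end Summit.CriticalPhenomena.SAWScalingLimit.Theorems.SubseqIdentification.BoundaryAreaLaw

end
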